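import Mathlib

/-!
# Connectedness in dimension `n` from punctured connectedness (Hartshorne-type combinatorics) —
# sub-goal (H3) of stub (R) `stub_raynaudConnectedness`

Route `SkinnerWilesDefectOne`, crux `ReducibleOrdinaryProModular` (stmt-Langlands-12919), line
`fine-selmer-codimension-two`, registered stub (R) `stub_raynaudConnectedness` (Grothendieck's
connectedness theorem [SGA2 XIII 2.1] in CROSSING FORM: for every two-colouring of the minimal
primes of `R` using both colours, two minimal primes `C₁, C₂` of different colours have
`n ≤ dim R/(C₁ + C₂)`).  This file proves, sorry-free, the purely order-theoretic reduction step
(H3) of the lead's programme, in the spirit of [Hartshorne 1962, Prop. 1.1 and the proof of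
Thm. 2.2]:

**If the punctured spectrum of the Noetherian local ring `R` is connected (crossing form with bound
`1`), and the punctured spectrum of `R_p` is connected for every non-maximal prime `p` with
`dim R/p + 1 ≤ n`, then `Spec R` is connected in dimension `n` (crossing form with bound `n`).**

Proof (`Theorems.crossing_of_crossing_localization`).  Suppose no crossing `C₁ + C₂` (`C₁ ∈ S`,
`C₂ ∉ S`, both minimal) has `n ≤ dim R/(C₁ + C₂)`.  Let `T` be the set of NON-MAXIMAL primes lying
above some crossing.  By punctured connectedness of `R` some crossing has `1 ≤ dim R/(C₁ + C₂)`,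
i.e. lies below a non-maximal prime, so `T ≠ ∅`; pick `p ∈ T` of least height (heights are finite,
`R` Noetherian).  Then `dim R/p ≤ dim R/(C₁ + C₂) < n`, so the hypothesis applies at `p`.  Colour
`Spec R_p` by pulling back `S` along the contraction map (primes of `R_p` = primes of `R` below `p`,
minimal primes corresponding to minimal primes, Mathlib `IsLocalization.minimalPrimes_map`); both
colours occur since `C₁, C₂ ⊆ p`.  Punctured connectedness of `R_p` yields minimal `q₁ ∈ S_p`,
`q₂ ∉ S_p` and a NON-MAXIMAL prime `Q ⊇ q₁ + q₂` of `R_p`; its contraction is a prime of `T`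
strictly below `p` — contradicting the minimality of the height of `p`.

Contents:
* `Theorems.exists_lt_of_one_le_ringKrullDim_quotient`,
  `Theorems.PrimeSpectrum.ne_maximalIdeal_of_lt` — `1 ≤ dim A/I` produces primes `I ⊆ P < Q`,
  and then `P ≠ 𝔪`;
* `Theorems.comap_localization_le`, `Theorems.comap_localization_lt_iff`,
  `Theorems.mem_minimalPrimes_localization_iff`, `Theorems.exists_comap_localization_eq`,
  `Theorems.exists_comap_localization_eq_of_mem_minimalPrimes` — the dictionary between
  `Spec A_p` and the primes of `A` below `p` (thin wrappers around Mathlib's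
  `IsLocalization.under_le_under_iff`, `IsLocalization.minimalPrimes_map`,
  `Ideal.isPrime_map_of_isLocalizationAtPrime`, `Ideal.under_map_of_isLocalizationAtPrime`,
  `Localization.AtPrime.under_maximalIdeal`);
* `Theorems.crossing_of_crossing_localization` — the theorem above, for any universe;
* `FineSelmerCodimensionTwo.stub_raynaudConnectedness_auxCodimOneOfPunctured` — the REGISTERED
  sub-goal (H3), binders verbatim, at universe `0`.

Not here: the inputs (H1)/(H2) themselves (Hartshorne's connectedness theorem for `R` and its
localizations, files `…HartshorneConnectedness.lean`, `…CohenMacaulayConnectedness.lean`), and the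
assembly of stub (R).

References: R. Hartshorne, *Complete intersections and connectedness*, Amer. J. Math. 84 (1962)
497–508, Prop. 1.1, Thm. 2.2 [Hartshorne1962]; A. Grothendieck, SGA 2, Exp. XIII Thm. 2.1
[Grothendieck1968SGA2]; M. Brodmann, R. Sharp, *Local cohomology*, CUP 1998, 19.2
[BrodmannSharp1998].
-/

set_option linter.dupNamespace false -- `Summit.Langlands.Langlands` is the mandated namespace
set_option autoImplicit false

namespace Summit.Langlands.Langlands.Theorems

open IsLocalRing

universe u

variable {A : Type u} [CommRing A]

/-! ## 1. Chains of length one above an ideal -/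

/-- If `dim A/I ≥ 1` then there are primes `I ⊆ P < Q`. [folklore] -/
theorem exists_lt_of_one_le_ringKrullDim_quotient {I : Ideal A}
    (h : (1 : WithBot ℕ∞) ≤ ringKrullDim (A ⧸ I)) :
    ∃ P Q : PrimeSpectrum A, I ≤ P.asIdeal ∧ P < Q := by
  rw [ringKrullDim_quotient, Order.one_le_krullDim_iff] at h
  obtain ⟨x, y, hxy⟩ := h
  exact ⟨x.1, y.1, fun r hr => x.2 hr, hxy⟩

/-- In a local ring a prime strictly below another prime is not the maximal ideal. [folklore] -/
theorem PrimeSpectrum.ne_maximalIdeal_of_lt [IsLocalRing A] {P Q : PrimeSpectrum A} (h : P < Q) :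
    P.asIdeal ≠ maximalIdeal A := by
  intro hP
  have hQ : Q.asIdeal ≤ maximalIdeal A := IsLocalRing.le_maximalIdeal Q.isPrime.ne_top
  rw [← hP] at hQ
  exact (lt_iff_le_not_ge.mp h).2 ((PrimeSpectrum.asIdeal_le_asIdeal Q P).mp hQ)

/-! ## 2. `Spec A_p` versus the primes of `A` below `p` -/

section Localization

variable (p : Ideal A) [p.IsPrime]

/-- The contraction of a prime of `A_p` lies below `p`. [folklore] -/
theorem comap_localization_le (q : PrimeSpectrum (Localization.AtPrime p)) :
    (PrimeSpectrum.comap (algebraMap A (Localization.AtPrime p)) q).asIdeal ≤ p := by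
  calc (PrimeSpectrum.comap (algebraMap A (Localization.AtPrime p)) q).asIdeal
        ≤ (maximalIdeal (Localization.AtPrime p)).under A :=
          Ideal.comap_mono (IsLocalRing.le_maximalIdeal q.isPrime.ne_top)
    _ = p := Localization.AtPrime.under_maximalIdeal

/-- Contraction `Spec A_p → Spec A` preserves and reflects strict inclusions. [folklore] -/
theorem comap_localization_lt_iff {q q' : PrimeSpectrum (Localization.AtPrime p)} :
    PrimeSpectrum.comap (algebraMap A (Localization.AtPrime p)) q <
      PrimeSpectrum.comap (algebraMap A (Localization.AtPrime p)) q' ↔ q < q' := by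
  have hle : ∀ {Q Q' : PrimeSpectrum (Localization.AtPrime p)},
      PrimeSpectrum.comap (algebraMap A (Localization.AtPrime p)) Q ≤
        PrimeSpectrum.comap (algebraMap A (Localization.AtPrime p)) Q' ↔ Q ≤ Q' := by
    intro Q Q'
    rw [← PrimeSpectrum.asIdeal_le_asIdeal, ← PrimeSpectrum.asIdeal_le_asIdeal,
      PrimeSpectrum.comap_asIdeal, PrimeSpectrum.comap_asIdeal]
    exact IsLocalization.under_le_under_iff p.primeCompl (Localization.AtPrime p)
  rw [lt_iff_le_not_ge, lt_iff_le_not_ge, hle, hle]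

/-- A prime of `A_p` is a minimal prime of `A_p` iff its contraction is a minimal prime of `A`
(Mathlib's `IsLocalization.minimalPrimes_map` at `J = 0`). [folklore] -/
theorem mem_minimalPrimes_localization_iff (q : PrimeSpectrum (Localization.AtPrime p)) :
    q.asIdeal ∈ minimalPrimes (Localization.AtPrime p) ↔
      (PrimeSpectrum.comap (algebraMap A (Localization.AtPrime p)) q).asIdeal ∈
        minimalPrimes A := by
  have h := IsLocalization.minimalPrimes_map p.primeCompl (Localization.AtPrime p) (⊥ : Ideal A)
  rw [Ideal.map_bot] at h
  exact Set.ext_iff.mp h q.asIdeal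

/-- Every prime of `A` below `p` is the contraction of a prime of `A_p` (namely of its extension).
[folklore] -/
theorem exists_comap_localization_eq {P : PrimeSpectrum A} (hP : P.asIdeal ≤ p) :
    ∃ q : PrimeSpectrum (Localization.AtPrime p),
      PrimeSpectrum.comap (algebraMap A (Localization.AtPrime p)) q = P := by
  refine ⟨⟨P.asIdeal.map (algebraMap A (Localization.AtPrime p)),
    Ideal.isPrime_map_of_isLocalizationAtPrime p hP⟩, ?_⟩
  ext1
  exact Ideal.under_map_of_isLocalizationAtPrime p hP

/-- A minimal prime of `A` below `p` is the contraction of a minimal prime of `A_p`. [folklore] -/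
theorem exists_comap_localization_eq_of_mem_minimalPrimes {C : PrimeSpectrum A}
    (hC : C.asIdeal ∈ minimalPrimes A) (hCp : C.asIdeal ≤ p) :
    ∃ c : PrimeSpectrum (Localization.AtPrime p),
      PrimeSpectrum.comap (algebraMap A (Localization.AtPrime p)) c = C ∧
        c.asIdeal ∈ minimalPrimes (Localization.AtPrime p) := by
  obtain ⟨c, hc⟩ := exists_comap_localization_eq p hCp
  refine ⟨c, hc, ?_⟩
  rw [mem_minimalPrimes_localization_iff, hc]
  exact hC

end Localization

/-! ## 3. Connectedness in dimension `n` from punctured connectedness of `R` and of the `R_p` -/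

/-- **Connectedness in dimension `n` from punctured connectedness** (Hartshorne-type combinatorics,
cf. [Hartshorne 1962, Prop. 1.1, proof of Thm. 2.2]; the reduction step (H3) towards SGA2 XIII 2.1).
Let `A` be Noetherian local and `n : ℕ`.  Assume (H1) for every two-colouring `S` of the minimal
primes of `A` using both colours there are minimal `C₁ ∈ S`, `C₂ ∉ S` with `1 ≤ dim A/(C₁ + C₂)`
(the punctured spectrum is connected), and (H2) the same holds for `A_p` for every non-maximal
prime `p` with `dim A/p + 1 ≤ n`.  Then for every such `S` there are minimal `C₁ ∈ S`, `C₂ ∉ S`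
with `n ≤ dim A/(C₁ + C₂)`.  Proof: otherwise take a non-maximal prime `p` of least height lying
above a crossing (one exists by (H1)); (H2) at `p`, applied to the pulled-back colouring of
`Spec A_p`, gives a crossing of `A` below a non-maximal prime of `A_p`, whose contraction is a
prime of smaller height above a crossing — contradiction. [cite: Hartshorne1962, Prop. 1.1] -/
theorem crossing_of_crossing_localization [IsNoetherianRing A] [IsLocalRing A] (n : ℕ)
    (H1 : ∀ S : Set (PrimeSpectrum A), (∃ C ∈ S, C.asIdeal ∈ minimalPrimes A) →
      (∃ C ∉ S, C.asIdeal ∈ minimalPrimes A) →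
        ∃ C₁ ∈ S, ∃ C₂ ∉ S, C₁.asIdeal ∈ minimalPrimes A ∧ C₂.asIdeal ∈ minimalPrimes A ∧
          (1 : WithBot ℕ∞) ≤ ringKrullDim (A ⧸ (C₁.asIdeal ⊔ C₂.asIdeal)))
    (H2 : ∀ p : PrimeSpectrum A, p.asIdeal ≠ maximalIdeal A →
      ringKrullDim (A ⧸ p.asIdeal) + 1 ≤ (n : WithBot ℕ∞) →
        ∀ S : Set (PrimeSpectrum (Localization.AtPrime p.asIdeal)),
          (∃ C ∈ S, C.asIdeal ∈ minimalPrimes (Localization.AtPrime p.asIdeal)) →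
          (∃ C ∉ S, C.asIdeal ∈ minimalPrimes (Localization.AtPrime p.asIdeal)) →
            ∃ C₁ ∈ S, ∃ C₂ ∉ S, C₁.asIdeal ∈ minimalPrimes (Localization.AtPrime p.asIdeal) ∧
              C₂.asIdeal ∈ minimalPrimes (Localization.AtPrime p.asIdeal) ∧
              (1 : WithBot ℕ∞) ≤
                ringKrullDim (Localization.AtPrime p.asIdeal ⧸ (C₁.asIdeal ⊔ C₂.asIdeal)))
    (S : Set (PrimeSpectrum A)) (h₁ : ∃ C ∈ S, C.asIdeal ∈ minimalPrimes A)
    (h₂ : ∃ C ∉ S, C.asIdeal ∈ minimalPrimes A) :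
    ∃ C₁ ∈ S, ∃ C₂ ∉ S, C₁.asIdeal ∈ minimalPrimes A ∧ C₂.asIdeal ∈ minimalPrimes A ∧
      (n : WithBot ℕ∞) ≤ ringKrullDim (A ⧸ (C₁.asIdeal ⊔ C₂.asIdeal)) := by
  classical
  by_contra H
  push Not at H
  -- `T`: the non-maximal primes lying above some crossing `C₁ + C₂`
  set T : Set (PrimeSpectrum A) := {P | P.asIdeal ≠ maximalIdeal A ∧
      ∃ C₁ ∈ S, ∃ C₂ ∉ S, C₁.asIdeal ∈ minimalPrimes A ∧ C₂.asIdeal ∈ minimalPrimes A ∧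
        C₁.asIdeal ⊔ C₂.asIdeal ≤ P.asIdeal} with hT
  -- `T` is nonempty: the punctured spectrum of `A` is connected (H1)
  have hTne : T.Nonempty := by
    obtain ⟨C₁, hC₁S, C₂, hC₂S, hC₁, hC₂, hdim⟩ := H1 S h₁ h₂
    obtain ⟨P, Q, hIP, hPQ⟩ := exists_lt_of_one_le_ringKrullDim_quotient hdim
    exact ⟨P, PrimeSpectrum.ne_maximalIdeal_of_lt hPQ, C₁, hC₁S, C₂, hC₂S, hC₁, hC₂, hIP⟩
  -- a member `p` of `T` of least height (heights in a Noetherian ring are finite)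
  obtain ⟨p, hpT, hpmin⟩ :=
    (InvImage.wf (fun P : PrimeSpectrum A => P.asIdeal.height) wellFounded_lt).has_min T hTne
  obtain ⟨hpm, C₁, hC₁S, C₂, hC₂S, hC₁, hC₂, hCp⟩ := hpT
  -- `dim A/p + 1 ≤ n`, since `dim A/p ≤ dim A/(C₁ + C₂) < n`
  have hdimp : ringKrullDim (A ⧸ p.asIdeal) + 1 ≤ (n : WithBot ℕ∞) :=
    ENat.WithBot.add_one_le_natCast_iff.mpr (lt_of_le_of_lt
      (ringKrullDim_le_of_surjective (Ideal.Quotient.factor hCp)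
        (Ideal.Quotient.factor_surjective hCp))
      (H C₁ hC₁S C₂ hC₂S hC₁ hC₂))
  -- colour `Spec A_p` by pulling `S` back along the contraction `φ`; both colours occur
  -- (`C₁, C₂ ⊆ p`)
  let φ : PrimeSpectrum (Localization.AtPrime p.asIdeal) → PrimeSpectrum A :=
    PrimeSpectrum.comap (algebraMap A (Localization.AtPrime p.asIdeal))
  have h₁' : ∃ C ∈ φ ⁻¹' S, C.asIdeal ∈ minimalPrimes (Localization.AtPrime p.asIdeal) := by
    obtain ⟨c, hc, hcmin⟩ :=
      exists_comap_localization_eq_of_mem_minimalPrimes p.asIdeal hC₁ (le_sup_left.trans hCp)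
    exact ⟨c, show PrimeSpectrum.comap (algebraMap A (Localization.AtPrime p.asIdeal)) c ∈ S by
      rw [hc]; exact hC₁S, hcmin⟩
  have h₂' : ∃ C ∉ φ ⁻¹' S, C.asIdeal ∈ minimalPrimes (Localization.AtPrime p.asIdeal) := by
    obtain ⟨c, hc, hcmin⟩ :=
      exists_comap_localization_eq_of_mem_minimalPrimes p.asIdeal hC₂ (le_sup_right.trans hCp)
    exact ⟨c, show PrimeSpectrum.comap (algebraMap A (Localization.AtPrime p.asIdeal)) c ∉ S by
      rw [hc]; exact hC₂S, hcmin⟩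
  -- the punctured spectrum of `A_p` is connected (H2): a crossing `q₁ + q₂` below a non-maximal `Q`
  obtain ⟨q₁, hq₁S, q₂, hq₂S, hq₁, hq₂, hdim₁⟩ := H2 p hpm hdimp (φ ⁻¹' S) h₁' h₂'
  obtain ⟨Q, Q', hqQ, hQQ'⟩ := exists_lt_of_one_le_ringKrullDim_quotient hdim₁
  -- its contraction `φ Q` lies in `T` strictly below `p`: contradiction with the minimality of `p`
  have hlt : φ Q < p :=
    lt_of_lt_of_le ((comap_localization_lt_iff p.asIdeal).mpr hQQ')
      ((PrimeSpectrum.asIdeal_le_asIdeal _ _).mp (comap_localization_le p.asIdeal Q'))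
  have hQT : φ Q ∈ T := by
    refine ⟨PrimeSpectrum.ne_maximalIdeal_of_lt hlt, φ q₁, hq₁S, φ q₂, hq₂S,
      (mem_minimalPrimes_localization_iff p.asIdeal q₁).mp hq₁,
      (mem_minimalPrimes_localization_iff p.asIdeal q₂).mp hq₂, ?_⟩
    exact sup_le (Ideal.comap_mono (le_sup_left.trans hqQ))
      (Ideal.comap_mono (le_sup_right.trans hqQ))
  exact hpmin (φ Q) hQT (Ideal.height_strict_mono_of_isPrime
    ((PrimeSpectrum.asIdeal_lt_asIdeal _ _).mpr hlt))

end Summit.Langlands.Langlands.Theorems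

/-! ## 4. The registered sub-goal (verbatim signature) -/

namespace Summit.Langlands.Langlands.Cruxes.ReducibleOrdinaryProModular.FineSelmerCodimensionTwo

/-- **Registered sub-goal (H3) `stub_raynaudConnectedness_auxCodimOneOfPunctured` of stub (R)
`stub_raynaudConnectedness`** (line fine-selmer-codimension-two): connectedness of `Spec R` in
dimension `n` (crossing form) from punctured connectedness of `R` and of the localizations `R_p` at
the non-maximal primes `p` with `dim R/p + 1 ≤ n` — `Theorems.crossing_of_crossing_localization` at
universe `0`, binders verbatim as registered. [cite: Hartshorne1962, Prop. 1.1] -/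
theorem stub_raynaudConnectedness_auxCodimOneOfPunctured :
    ∀ (R : Type) [CommRing R] [IsNoetherianRing R] [IsLocalRing R] (n : ℕ),
      (∀ S : Set (PrimeSpectrum R), (∃ C ∈ S, C.asIdeal ∈ minimalPrimes R) →
        (∃ C ∉ S, C.asIdeal ∈ minimalPrimes R) → ∃ C₁ ∈ S, ∃ C₂ ∉ S,
          C₁.asIdeal ∈ minimalPrimes R ∧ C₂.asIdeal ∈ minimalPrimes R ∧
            (1 : WithBot ℕ∞) ≤ ringKrullDim (R ⧸ (C₁.asIdeal ⊔ C₂.asIdeal))) →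
      (∀ p : PrimeSpectrum R, p.asIdeal ≠ IsLocalRing.maximalIdeal R →
        ringKrullDim (R ⧸ p.asIdeal) + 1 ≤ (n : WithBot ℕ∞) →
          ∀ S : Set (PrimeSpectrum (Localization.AtPrime p.asIdeal)),
            (∃ C ∈ S, C.asIdeal ∈ minimalPrimes (Localization.AtPrime p.asIdeal)) →
            (∃ C ∉ S, C.asIdeal ∈ minimalPrimes (Localization.AtPrime p.asIdeal)) →
              ∃ C₁ ∈ S, ∃ C₂ ∉ S, C₁.asIdeal ∈ minimalPrimes (Localization.AtPrime p.asIdeal) ∧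
                C₂.asIdeal ∈ minimalPrimes (Localization.AtPrime p.asIdeal) ∧
                  (1 : WithBot ℕ∞) ≤
                    ringKrullDim (Localization.AtPrime p.asIdeal ⧸ (C₁.asIdeal ⊔ C₂.asIdeal))) →
      ∀ S : Set (PrimeSpectrum R), (∃ C ∈ S, C.asIdeal ∈ minimalPrimes R) →
        (∃ C ∉ S, C.asIdeal ∈ minimalPrimes R) → ∃ C₁ ∈ S, ∃ C₂ ∉ S,
          C₁.asIdeal ∈ minimalPrimes R ∧ C₂.asIdeal ∈ minimalPrimes R ∧
            (n : WithBot ℕ∞) ≤ ringKrullDim (R ⧸ (C₁.asIdeal ⊔ C₂.asIdeal)) :=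
  fun _ _ _ _ n H1 H2 S h₁ h₂ =>
    Summit.Langlands.Langlands.Theorems.crossing_of_crossing_localization n H1 H2 S h₁ h₂

end Summit.Langlands.Langlands.Cruxes.ReducibleOrdinaryProModular.FineSelmerCodimensionTwo
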